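/-
Copyright: cell `pub-balaban-gaps` (G2), seat ne6 (row NE7b), `prover-pub-balaban-gaps-ne6-g16-0`. Project licence.
-/
import Mathlib.Analysis.SpecialFunctions.Trigonometric.Deriv
import Mathlib.Analysis.SpecialFunctions.Trigonometric.Inverse
import Mathlib.Analysis.Calculus.Deriv.MeanValue

/-!
# WINDOW DOUBLING ON `SU(2)` WITH THE SHARP CONSTANT `D = 1`: the cap profile `ψ ↦ (ψ − sin ψ cos ψ)∕sin³(ψ∕2)` is non-increasing on `(0, π]`,
# hence any window function with the `SU(2)` cap-law shape satisfies `m(λ²t) ≤ λ³·m(t)` (`λ ≥ 1`) (row NE7b, node U5c; MODEL, [folklore]; census V40b)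

Cell `pub-balaban-gaps` (G2 spine census) for the `pub-balaban` T⁴ crux NE7b (`T4WeightBudget.RelWeightBound`; NOT PRINTED, NOT PROVED).  Crux-route work under
`Spine/NE7b/`; Mathlib only (real one-variable calculus); no `def`, zero `sorry`, nothing of Bałaban's asserted.  LETTER-ABSTRACT JUNCTION: the cap law enters as the
HYPOTHESIS `hlaw` of `doubling_one_of_capLaw` and is SUPPLIED for Haar on `SU(2)` by the sibling census file V40a `CompactFibreWindowSU2Exact.haar_traceCap_angle_eq`
(`Haar_{SU(2)}{Re tr V ≥ 2 cos ψ} = (ψ − sin ψ cos ψ)∕π`, staged by this seat; its olean is not yet built on the check farm, so it is not imported here — the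
one-line instantiation is a successor's junction).

THE LOCATED QUESTION (census V40, refuter NE7bREF-G99-POST3 on V38 `CompactFibreHalvedActionSUN`): V38 proved the window DOUBLING
`Haar{‖V − 1‖ ≤ λη} ≤ D·λ^{N²−1}·Haar{‖V − 1‖ ≤ η}` with the SOFT constant `D = C²`; the refuter's quadrature reads `D_true = 1` for `N = 2, 3`.  IS `D = 1` A THEOREM FOR
`SU(2)`?  ANSWER (this file + V40a): YES.
* §1 `hasDerivAt_aux`, **`aux_nonneg`**: `h(ψ) = 3ψ − 4 sin ψ + sin ψ cos ψ` has `h′ = 2(1 − cos ψ)² ≥ 0`, `h(0) = 0`, so `h ≥ 0` on `[0, ∞)`.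
* §2 `hasDerivAt_capFun` (`(ψ − sin ψ cos ψ)′ = 2 sin²ψ`), `hasDerivAt_sinHalf_cube`, **`hasDerivAt_capProfile`** (the profile `G = F∕sin³(·∕2)` has
  `G′ = −(sin²(ψ∕2) cos(ψ∕2)∕2)·h(ψ)∕sin⁶(ψ∕2)` — the numerator identity by `sin ψ = 2 sin(ψ∕2)cos(ψ∕2)`, `cos ψ = 1 − 2 sin²(ψ∕2)`), and
  **`antitoneOn_capProfile`**: `G` is non-increasing on `(0, π]` (`antitoneOn_of_deriv_nonpos`).
* §3 `two_sub_two_cos` (`2 − 2cos ψ = 4 sin²(ψ∕2)`), `exists_angle_of_level` (`0 < t ≤ 4 ⇒ t = 2 − 2cos ψ_t`, `ψ_t = arccos(1 − t∕2) ∈ (0, π]`), `capFun_nonneg`, and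
  **`doubling_one_of_capLaw`**: for `m : ℝ → ℝ` with `m(2 − 2cos ψ) = (ψ − sin ψ cos ψ)∕π` on `[0, π]`, `m ≤ 1`, `m = 1` on `[4, ∞)`, `m = 0` on `(−∞, 0)`:
  `m(λ²·t) ≤ λ³·m(t)` for all `λ ≥ 1`, all real `t` (levels `≤ 4`: the profile at `ψ_t ≤ ψ_{λ²t}` with `sin(ψ_{λ²t}∕2) = λ sin(ψ_t∕2)`; level `λ²t > 4 ≥ t`: the profile
  at `ψ_t` vs `π` gives `π sin³(ψ_t∕2) ≤ ψ_t − sin ψ_t cos ψ_t`, and `λ sin(ψ_t∕2) > 1`).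
With V40a this is V38's doubling on `SU(2)` at the trace window `{Re tr(1 − V) ≤ t}` with `D = 1`, hence (by V38's layer cake) the halved-action letter of the `SU(2)`
reference state with the additive constant `c = 0`: `∫e^{δβs}e^{−βs} dHaar ≤ (1−δ)^{−3∕2}·∫e^{−βs} dHaar` — the refuter's instrument no. 7 as a theorem, once the
two junctions are typed (successor; both need oleans of V38 ∕ V40a).

HONEST REMARKS.  MODEL ∕ [folklore] calculus; nothing of the interacting measure; `SU(3)` (`D_true = 1` by the refuter's quadrature as well) is NOT treated — its window law
needs the rank-2 Weyl formula.  (A3) ∕ (A1c) NOT asserted; NC-NE7b-α UNRULED.  BY-NAME EFFECT ON THE WALL: NONE.  NE7b NOT PRINTED ∕ NOT PROVED; spine PROVED 0∕9;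
rung (B)+1 on ONE finite T⁴ — NOT infinite volume, NOT the mass gap, NOT Clay.
HONEST DEPENDENCY: continuum YM on T⁴ ⇐ BetaPertH ∧ nine spine estimates (0/9 proved); BetaPertH ⇐ (D1) ∧ (D4) ∧ CAP+tail;
G-an2-4 gates asym, D1 and NE2/3/4.  This file changes none of it.
-/

set_option autoImplicit false

noncomputable section

open Real Set

namespace Summit.QuantumFields.BalabanUV.T4Continuum.NE7b.CompactFibreWindowSU2Doubling

/-! ## §1 The auxiliary function `h(ψ) = 3ψ − 4 sin ψ + sin ψ cos ψ`: `h' = 2(1 − cos ψ)² ≥ 0`, `h(0) = 0`, so `h ≥ 0` on `[0, ∞)` -/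

/-- `h(ψ) = 3ψ − 4 sin ψ + sin ψ cos ψ` has derivative `2(1 − cos ψ)²`. [folklore] -/
theorem hasDerivAt_aux (ψ : ℝ) : HasDerivAt (fun x : ℝ => 3 * x - 4 * Real.sin x + Real.sin x * Real.cos x) (2 * (1 - Real.cos ψ) ^ 2) ψ := by
  have h1 : HasDerivAt (fun x : ℝ => 3 * x) (3 * 1) ψ := (hasDerivAt_id ψ).const_mul 3
  have h2 : HasDerivAt (fun x : ℝ => 4 * Real.sin x) (4 * Real.cos ψ) ψ := (Real.hasDerivAt_sin ψ).const_mul 4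
  have h3 : HasDerivAt (fun x : ℝ => Real.sin x * Real.cos x) (Real.cos ψ * Real.cos ψ + Real.sin ψ * -Real.sin ψ) ψ :=
    (Real.hasDerivAt_sin ψ).mul (Real.hasDerivAt_cos ψ)
  refine ((h1.sub h2).add h3).congr_deriv ?_
  nlinarith [Real.sin_sq_add_cos_sq ψ]

/-- `h ≥ 0` on `[0, ∞)`. [folklore] -/
theorem aux_nonneg {ψ : ℝ} (hψ : 0 ≤ ψ) : 0 ≤ 3 * ψ - 4 * Real.sin ψ + Real.sin ψ * Real.cos ψ := by
  have hmono : Monotone (fun x : ℝ => 3 * x - 4 * Real.sin x + Real.sin x * Real.cos x) :=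
    monotone_of_deriv_nonneg (fun x => (hasDerivAt_aux x).differentiableAt) fun x => by
      rw [(hasDerivAt_aux x).deriv]; positivity
  have h0 := hmono hψ
  simpa using h0


/-! ## §2 The cap profile `G(ψ) = (ψ − sin ψ cos ψ)∕sin³(ψ∕2)` is non-increasing on `(0, π]` -/

/-- The cap function `F(ψ) = ψ − sin ψ cos ψ` has derivative `2 sin²ψ`. [folklore] -/
theorem hasDerivAt_capFun (ψ : ℝ) : HasDerivAt (fun x : ℝ => x - Real.sin x * Real.cos x) (2 * Real.sin ψ ^ 2) ψ := by
  have h3 : HasDerivAt (fun x : ℝ => Real.sin x * Real.cos x) (Real.cos ψ * Real.cos ψ + Real.sin ψ * -Real.sin ψ) ψ :=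
    (Real.hasDerivAt_sin ψ).mul (Real.hasDerivAt_cos ψ)
  refine ((hasDerivAt_id ψ).sub h3).congr_deriv ?_
  nlinarith [Real.sin_sq_add_cos_sq ψ]

/-- `sin³(ψ∕2)` has derivative `(3∕2)·sin²(ψ∕2)·cos(ψ∕2)`. [folklore] -/
theorem hasDerivAt_sinHalf_cube (ψ : ℝ) : HasDerivAt (fun x : ℝ => Real.sin (x / 2) ^ 3) (3 / 2 * Real.sin (ψ / 2) ^ 2 * Real.cos (ψ / 2)) ψ := by
  have h1 : HasDerivAt (fun x : ℝ => x / 2) (1 / 2) ψ := by simpa using (hasDerivAt_id ψ).div_const 2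
  have h2 : HasDerivAt (fun x : ℝ => Real.sin (x / 2)) (Real.cos (ψ / 2) * (1 / 2)) ψ := h1.sin
  refine (h2.pow 3).congr_deriv ?_
  push_cast
  ring

/-- The derivative of the cap profile `G = F∕sin³(·∕2)` on `(0, 2π)` and its SIGN: `G′(ψ) = −(sin²(ψ∕2)·cos(ψ∕2)∕2)·h(ψ)∕sin⁶(ψ∕2)`. [folklore] -/
theorem hasDerivAt_capProfile {ψ : ℝ} (hs : Real.sin (ψ / 2) ≠ 0) :
    HasDerivAt (fun x : ℝ => (x - Real.sin x * Real.cos x) / Real.sin (x / 2) ^ 3)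
      (-(Real.sin (ψ / 2) ^ 2 * Real.cos (ψ / 2) / 2 * (3 * ψ - 4 * Real.sin ψ + Real.sin ψ * Real.cos ψ)) / (Real.sin (ψ / 2) ^ 3) ^ 2) ψ := by
  have h := (hasDerivAt_capFun ψ).div (hasDerivAt_sinHalf_cube ψ) (pow_ne_zero 3 hs)
  refine h.congr_deriv ?_
  -- the numerator identity, from `sin ψ = 2 sin(ψ/2)cos(ψ/2)` and `cos ψ = 1 − 2 sin²(ψ/2)`
  have hsin : Real.sin ψ = 2 * Real.sin (ψ / 2) * Real.cos (ψ / 2) := by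
    have h := Real.sin_two_mul (ψ / 2); rwa [show 2 * (ψ / 2) = ψ by ring] at h
  have hcos : Real.cos ψ = 1 - 2 * Real.sin (ψ / 2) ^ 2 := by
    have h := Real.cos_sq (ψ / 2); rw [show 2 * (ψ / 2) = ψ by ring] at h
    nlinarith [Real.sin_sq_add_cos_sq (ψ / 2)]
  congr 1
  set s := Real.sin (ψ / 2)
  set c := Real.cos (ψ / 2)
  linear_combination (2 * s ^ 3 * Real.sin ψ) * hsin + (2 * s ^ 2 * c * Real.sin ψ) * hcos


/-- **THE CAP PROFILE IS NON-INCREASING**: `ψ ↦ (ψ − sin ψ cos ψ)∕sin³(ψ∕2)` is antitone on `(0, π]`. [folklore] -/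
theorem antitoneOn_capProfile : AntitoneOn (fun x : ℝ => (x - Real.sin x * Real.cos x) / Real.sin (x / 2) ^ 3) (Set.Ioc 0 Real.pi) := by
  have hsin_pos : ∀ x ∈ Set.Ioc (0 : ℝ) Real.pi, 0 < Real.sin (x / 2) := fun x hx =>
    Real.sin_pos_of_pos_of_lt_pi (by linarith [hx.1]) (by linarith [hx.2, Real.pi_pos])
  have hcos_nn : ∀ x ∈ Set.Ioo (0 : ℝ) Real.pi, 0 ≤ Real.cos (x / 2) := fun x hx =>
    Real.cos_nonneg_of_mem_Icc ⟨by linarith [hx.1, Real.pi_pos], by linarith [hx.2]⟩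
  refine antitoneOn_of_deriv_nonpos (convex_Ioc 0 Real.pi) ?_ ?_ ?_
  · exact fun x hx => (hasDerivAt_capProfile (hsin_pos x hx).ne').continuousAt.continuousWithinAt
  · rw [interior_Ioc]
    exact fun x hx => (hasDerivAt_capProfile (hsin_pos x ⟨hx.1, hx.2.le⟩).ne').differentiableAt.differentiableWithinAt
  · rw [interior_Ioc]
    intro x hx
    rw [(hasDerivAt_capProfile (hsin_pos x ⟨hx.1, hx.2.le⟩).ne').deriv]
    have hh := aux_nonneg hx.1.le
    have hc := hcos_nn x hx
    apply div_nonpos_of_nonpos_of_nonneg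
    · have : 0 ≤ Real.sin (x / 2) ^ 2 * Real.cos (x / 2) / 2 * (3 * x - 4 * Real.sin x + Real.sin x * Real.cos x) := by positivity
      linarith
    · positivity


/-! ## §3 From the cap law to DOUBLING WITH THE SHARP CONSTANT `D = 1` -/

/-- `2 − 2 cos ψ = 4 sin²(ψ∕2)`. [folklore] -/
theorem two_sub_two_cos (ψ : ℝ) : 2 - 2 * Real.cos ψ = 4 * Real.sin (ψ / 2) ^ 2 := by
  have h := Real.cos_sq (ψ / 2); rw [show 2 * (ψ / 2) = ψ by ring] at h
  nlinarith [Real.sin_sq_add_cos_sq (ψ / 2)]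

/-- The angle of a window level: for `0 ≤ t ≤ 4`, `ψ_t := arccos(1 − t∕2) ∈ [0, π]` has `2 − 2 cos ψ_t = t`. [folklore] -/
theorem two_sub_two_cos_arccos {t : ℝ} (h0 : 0 ≤ t) (h4 : t ≤ 4) : 2 - 2 * Real.cos (Real.arccos (1 - t / 2)) = t := by
  rw [Real.cos_arccos (by linarith) (by linarith)]; ring

/-- The cap function is nonnegative on `[0, ∞)` (`ψ − sin ψ cos ψ = ψ − ½ sin 2ψ ≥ 0`). [folklore] -/
theorem capFun_nonneg {ψ : ℝ} (hψ : 0 ≤ ψ) : 0 ≤ ψ - Real.sin ψ * Real.cos ψ := by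
  have hmono : Monotone (fun x : ℝ => x - Real.sin x * Real.cos x) :=
    monotone_of_deriv_nonneg (fun x => (hasDerivAt_capFun x).differentiableAt) fun x => by
      rw [(hasDerivAt_capFun x).deriv]; positivity
  simpa using hmono hψ

/-- A window level `0 < t ≤ 4` has an angle `ψ ∈ (0, π]` with `t = 4 sin²(ψ∕2) = 2 − 2cos ψ` and `sin(ψ∕2) > 0`. [folklore] -/
theorem exists_angle_of_level {t : ℝ} (h0 : 0 < t) (h4 : t ≤ 4) :
    ∃ ψ : ℝ, 0 < ψ ∧ ψ ≤ Real.pi ∧ 2 - 2 * Real.cos ψ = t ∧ t = 4 * Real.sin (ψ / 2) ^ 2 ∧ 0 < Real.sin (ψ / 2) ∧ ψ = Real.arccos (1 - t / 2) := by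
  set ψ := Real.arccos (1 - t / 2) with hψ
  have hψ0 : 0 ≤ ψ := Real.arccos_nonneg _
  have hψπ : ψ ≤ Real.pi := Real.arccos_le_pi _
  have htψ : 2 - 2 * Real.cos ψ = t := two_sub_two_cos_arccos h0.le h4
  have hs : t = 4 * Real.sin (ψ / 2) ^ 2 := by rw [← htψ, two_sub_two_cos]
  have hψpos : 0 < ψ := by
    rcases hψ0.eq_or_lt with h | h
    · exfalso; rw [← h, zero_div, Real.sin_zero] at hs; linarith
    · exact h
  exact ⟨ψ, hψpos, hψπ, htψ, hs, Real.sin_pos_of_pos_of_lt_pi (by linarith) (by linarith [Real.pi_pos]), rfl⟩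

/-- **DOUBLING WITH `D = 1` FROM THE CAP LAW.**  Let `m : ℝ → ℝ` have the `SU(2)` window-law shape: `m(2 − 2cos ψ) = (ψ − sin ψ cos ψ)∕π` for
`0 ≤ ψ ≤ π` (V40a `CompactFibreWindowSU2Exact.haar_traceCap_angle_eq` for `m t = Haar{Re tr(1 − V) ≤ t}`), `m t ≤ 1` everywhere, `m t = 1` for `t ≥ 4` and `m t = 0`
for `t < 0`.  Then `m(l²·t) ≤ l³·m(t)` for every `l ≥ 1` and every real `t` — V38's window doubling for `N = 2` with the SHARP constant `D = 1` (the refuter's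
`D_true = 1`): `t ↦ m(t)∕t^{3∕2}` is non-increasing. [folklore] -/
theorem doubling_one_of_capLaw (m : ℝ → ℝ)
    (hlaw : ∀ ψ : ℝ, 0 ≤ ψ → ψ ≤ Real.pi → m (2 - 2 * Real.cos ψ) = (ψ - Real.sin ψ * Real.cos ψ) / Real.pi)
    (hle1 : ∀ t, m t ≤ 1) (hbig : ∀ t, 4 ≤ t → m t = 1) (hneg : ∀ t, t < 0 → m t = 0) {l : ℝ} (hl : 1 ≤ l) (t : ℝ) :
    m (l ^ 2 * t) ≤ l ^ 3 * m t := by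
  have hl0 : 0 ≤ l := by linarith
  have hl3 : 1 ≤ l ^ 3 := one_le_pow₀ hl
  have hπ := Real.pi_pos
  rcases lt_trichotomy t 0 with ht | rfl | ht
  · rw [hneg t ht, hneg _ (by nlinarith), mul_zero]
  · have h00 : m 0 = 0 := by have := hlaw 0 le_rfl hπ.le; simpa using this
    rw [mul_zero, h00, mul_zero]
  by_cases ht4 : t ≤ 4
  swap
  · -- `t > 4`: `m t = 1` and `m(l²t) ≤ 1 ≤ l³`
    rw [hbig t (by linarith)]; linarith [hle1 (l ^ 2 * t)]
  obtain ⟨ψ, hψ0, hψπ, htψ, hs, hspos, hψdef⟩ := exists_angle_of_level ht ht4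
  have hmt : m t = (ψ - Real.sin ψ * Real.cos ψ) / Real.pi := by rw [← htψ]; exact hlaw ψ hψ0.le hψπ
  have hG := antitoneOn_capProfile
  set s₁ := Real.sin (ψ / 2) with hs₁
  by_cases hlt4 : l ^ 2 * t ≤ 4
  · obtain ⟨ψ', hψ'0, hψ'π, htψ', hs', hs'pos, hψ'def⟩ := exists_angle_of_level (by positivity : 0 < l ^ 2 * t) hlt4
    have hmt' : m (l ^ 2 * t) = (ψ' - Real.sin ψ' * Real.cos ψ') / Real.pi := by rw [← htψ']; exact hlaw ψ' hψ'0.le hψ'π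
    set s₂ := Real.sin (ψ' / 2) with hs₂
    -- `ψ ≤ ψ'` (arccos is antitone and `1 − l²t/2 ≤ 1 − t/2`)
    have hψle : ψ ≤ ψ' := by
      have hle : t ≤ l ^ 2 * t := le_mul_of_one_le_left ht.le (one_le_pow₀ hl)
      rw [hψdef, hψ'def]; exact Real.arccos_le_arccos (by linarith)
    -- `s₂ = l·s₁`
    have hss : s₂ = l * s₁ := by
      have h2 : s₂ ^ 2 = (l * s₁) ^ 2 := by nlinarith
      exact (pow_left_inj₀ hs'pos.le (by positivity) two_ne_zero).1 h2
    have hGle := hG ⟨hψ0, hψπ⟩ ⟨hψ'0, hψ'π⟩ hψle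
    simp only at hGle
    -- unfold the profile comparison: `F ψ' ≤ (F ψ / s₁³)·s₂³ = l³·F ψ`
    rw [div_le_iff₀ (pow_pos hs'pos 3)] at hGle
    rw [hmt', hmt, div_le_iff₀ hπ]
    calc ψ' - Real.sin ψ' * Real.cos ψ' ≤ (ψ - Real.sin ψ * Real.cos ψ) / s₁ ^ 3 * s₂ ^ 3 := hGle
      _ = l ^ 3 * (ψ - Real.sin ψ * Real.cos ψ) := by rw [hss]; field_simp
      _ = l ^ 3 * ((ψ - Real.sin ψ * Real.cos ψ) / Real.pi) * Real.pi := by field_simp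
  · -- `l²t > 4 ≥ t`: `m(l²t) ≤ 1 ≤ l³·m t` by comparing the profile at `ψ` and at `π`
    push Not at hlt4
    have hGπ := hG ⟨hψ0, hψπ⟩ ⟨Real.pi_pos, le_rfl⟩ hψπ
    simp only [Real.sin_pi, zero_mul, sub_zero, Real.sin_pi_div_two, one_pow, div_one] at hGπ
    -- `π ≤ F ψ / s₁³`, i.e. `π·s₁³ ≤ F ψ`; and `l·s₁ > 1`
    rw [le_div_iff₀ (pow_pos hspos 3)] at hGπ
    have hls : 1 < l * s₁ := by
      have h1 : 1 < (l * s₁) ^ 2 := by nlinarith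
      nlinarith [show 0 ≤ l * s₁ by positivity]
    have hls3 : 1 ≤ (l * s₁) ^ 3 := one_le_pow₀ hls.le
    rw [hmt]
    calc m (l ^ 2 * t) ≤ 1 := hle1 _
      _ ≤ (l * s₁) ^ 3 := hls3
      _ = l ^ 3 * (Real.pi * s₁ ^ 3) / Real.pi := by field_simp
      _ ≤ l ^ 3 * (ψ - Real.sin ψ * Real.cos ψ) / Real.pi := by gcongr
      _ = l ^ 3 * ((ψ - Real.sin ψ * Real.cos ψ) / Real.pi) := by ring

/-! ## §4 Sanity -/

/-- The hypotheses are jointly satisfiable and the conclusion is not vacuous: for the genuine cap-law function (any `m` as in the theorem) at `λ = 2`, `t = 1`: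
`m 4 ≤ 8·m 1`, i.e. `1 ≤ 8·m 1` — the cap of level `1` (angular radius `π∕3`) has mass `≥ 1∕8` (`(π∕3 − √3∕4)∕π ≈ 0.196`). [folklore] -/
example (m : ℝ → ℝ) (hlaw : ∀ ψ : ℝ, 0 ≤ ψ → ψ ≤ Real.pi → m (2 - 2 * Real.cos ψ) = (ψ - Real.sin ψ * Real.cos ψ) / Real.pi)
    (hle1 : ∀ t, m t ≤ 1) (hbig : ∀ t, 4 ≤ t → m t = 1) (hneg : ∀ t, t < 0 → m t = 0) : 1 ≤ 8 * m 1 := by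
  have h := doubling_one_of_capLaw m hlaw hle1 hbig hneg (by norm_num : (1 : ℝ) ≤ 2) 1
  rw [hbig _ (by norm_num)] at h
  norm_num at h
  linarith

end Summit.QuantumFields.BalabanUV.T4Continuum.NE7b.CompactFibreWindowSU2Doubling

end
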